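import Summits.CriticalPhenomena.PercolationContinuityZ3.Theorems.PercNearOneGluingAdditiveGluingBhkMenu
import Summits.CriticalPhenomena.PercolationContinuityZ3.Theorems.PercNearOneGluingAdditiveGluingBhkSets
import HarnessLib

/-! # Crux `PercNearOneGluing.AdditiveGluing` (stmt-CriticalPhenomena-4576): Kozma–Nitzan's Theorem 1 for a GLUED PAIR,
# in weighted form and written in the un-glued graph

Support file (`--supports stmt-CriticalPhenomena-4576`, lead prim-png-lead-4576).  No definitions, no named facts, no sorries.

For a set of relays `W` (below `W = {a₁, a₃}`, the tied worst pair of the three-relay problem) and a further relay `a₂ ∉ W`,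
let `N = {W ↮ a₂}`, `O_W = {o ∈ C(W)}`, `O₂ = {o ↔ a₂}`, `B_W = {b ∈ C(W)}`, `B₂ = {a₂ ↔ b}`, `α = μ(N ∩ O_W)`, `β = μ(N ∩ O₂)`.
**Theorem (`gluedPair_weightedThm1`).**
  `0 ≤ α·[μ(N ∩ O₂ ∩ B₂) − μ(N ∩ O₂ ∩ B_W)] + β·[μ(N ∩ O_W ∩ B_W) − μ(N ∩ O_W ∩ B₂)]`.
This is Kozma–Nitzan's Theorem 1 (arXiv:2401.12397, p. 8: "Applying BHK 4 times") for the relay pair `{w, a₂}` of the graph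
`G/W` (the pair glued to one vertex `w`) in its WEIGHTED form `α(P(E)−P(F_w)) + β(P(E)−P(F₂)) ≥ 0` (KN's (6) before normalising
`α, β`), written directly in `G`: on `N` the glued events coincide with the set events `O_W, B_W`, and the four van den
Berg–Häggström–Kahn inequalities for the SET cluster `C(W)` versus `C(a₂)` (the landed `stub_bhkSets`, instantiated through deep seat
r2's `bhkMenu_one/two`) replace BHK in `G/W`.  It is the provable half of the lead's glued-pair exchange route (T-d) to the three-relay
case (registered stub `stub_gluedPairExchangeTie_pl`; memo TD-MEMO.md): `(α+β)·[μ(a₃↮b) − μ(o↔A ∖ o↔b)] = WT + (α+β)·gap(T-d)` with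
`WT` the quantity shown nonnegative here.
[cite: KozmaNitzan2024, Theorem 1 (§3.1, pp. 7–8); VandenbergHaggstromKahn2005, Thms. 1.3–1.4]
-/

namespace Summit.CriticalPhenomena.PercolationContinuityZ3.Theorems

open MeasureTheory Set Literature.Probability.LatticeModels Literature.Probability.Percolation

noncomputable section
open Classical

variable {n : ℕ}

/-- The separation event `{S ↮ X}` written with a finset or with its coercion to a set is the same event. [folklore] -/
theorem gluedPair_sep_coe (S S' : Finset (Fin n)) :
    {ω : BondConfig (Fin n) | ∀ s ∈ S, ∀ x ∈ (S' : Set (Fin n)), ¬ (openGraph ω).Reachable s x} =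
      {ω : BondConfig (Fin n) | ∀ s ∈ S, ∀ x ∈ S', ¬ (openGraph ω).Reachable s x} := by
  ext ω; simp only [Set.mem_setOf_eq, Finset.mem_coe]

/-- The separation event is symmetric in the two sides. [folklore] -/
theorem gluedPair_sep_symm (S S' : Finset (Fin n)) :
    {ω : BondConfig (Fin n) | ∀ s ∈ S', ∀ x ∈ S, ¬ (openGraph ω).Reachable s x} =
      {ω : BondConfig (Fin n) | ∀ s ∈ S, ∀ x ∈ S', ¬ (openGraph ω).Reachable s x} := by
  ext ω
  simp only [Set.mem_setOf_eq]
  constructor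
  · intro h s hs x hx hr; exact h x hx s hs hr.symm
  · intro h s hs x hx hr; exact h x hx s hs hr.symm

/-- **Weighted Theorem 1 for a glued pair** (see the file header): with `N = {W ↮ S'}` for disjoint finsets `W, S'`,
`O_W = ⋃_{s∈W} {s↔o}`, `B_W = ⋃_{s∈W} {s↔b}`, `O' = ⋃_{s∈S'} {s↔o}`, `B' = ⋃_{s∈S'} {s↔b}`:
`0 ≤ μ(N∩O_W)·[μ(N∩(O'∩B')) − μ(N∩(O'∩B_W))] + μ(N∩O')·[μ(N∩(O_W∩B_W)) − μ(N∩(O_W∩B'))]`.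
Four set-BHK applications. [cite: KozmaNitzan2024, Theorem 1, proof (p. 8)] -/
theorem gluedPair_weightedThm1 (w : Sym2 (Fin n) → unitInterval) (W S' : Finset (Fin n)) (o b : Fin n)
    (hWS : Disjoint W S') :
    0 ≤ (prodBernoulli w).real ({ω : BondConfig (Fin n) | ∀ s ∈ W, ∀ x ∈ S', ¬ (openGraph ω).Reachable s x} ∩
            ⋃ s ∈ W, openConn s o) *
          ((prodBernoulli w).real ({ω : BondConfig (Fin n) | ∀ s ∈ W, ∀ x ∈ S', ¬ (openGraph ω).Reachable s x} ∩
              ((⋃ s ∈ S', openConn s o) ∩ ⋃ s ∈ S', openConn s b)) -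
            (prodBernoulli w).real ({ω : BondConfig (Fin n) | ∀ s ∈ W, ∀ x ∈ S', ¬ (openGraph ω).Reachable s x} ∩
              ((⋃ s ∈ S', openConn s o) ∩ ⋃ s ∈ W, openConn s b))) +
        (prodBernoulli w).real ({ω : BondConfig (Fin n) | ∀ s ∈ W, ∀ x ∈ S', ¬ (openGraph ω).Reachable s x} ∩
            ⋃ s ∈ S', openConn s o) *
          ((prodBernoulli w).real ({ω : BondConfig (Fin n) | ∀ s ∈ W, ∀ x ∈ S', ¬ (openGraph ω).Reachable s x} ∩
              ((⋃ s ∈ W, openConn s o) ∩ ⋃ s ∈ W, openConn s b)) -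
            (prodBernoulli w).real ({ω : BondConfig (Fin n) | ∀ s ∈ W, ∀ x ∈ S', ¬ (openGraph ω).Reachable s x} ∩
              ((⋃ s ∈ W, openConn s o) ∩ ⋃ s ∈ S', openConn s b))) := by
  set μ := prodBernoulli w with hμ
  set N : Set (BondConfig (Fin n)) := {ω | ∀ s ∈ W, ∀ x ∈ S', ¬ (openGraph ω).Reachable s x} with hN
  set OW : Set (BondConfig (Fin n)) := ⋃ s ∈ W, openConn s o with hOW
  set BW : Set (BondConfig (Fin n)) := ⋃ s ∈ W, openConn s b with hBW
  set O' : Set (BondConfig (Fin n)) := ⋃ s ∈ S', openConn s o with hO'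
  set B' : Set (BondConfig (Fin n)) := ⋃ s ∈ S', openConn s b with hB'
  have hWX : ∀ s ∈ W, s ∉ (S' : Set (Fin n)) := fun s hs hx =>
    Finset.disjoint_left.1 hWS hs (Finset.mem_coe.1 hx)
  have hXW : ∀ s ∈ S', s ∉ (W : Set (Fin n)) := fun s hs hx =>
    Finset.disjoint_left.1 hWS (Finset.mem_coe.1 hx) hs
  -- (1) Thm 1.3 in `C(W)`: `μ(N∩O_W) μ(N∩B_W) ≤ μ(N) μ(N∩(O_W∩B_W))`
  have h1 := bhkMenu_one stub_bhkSets.1 w W (S' : Set (Fin n))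
    {C | ∃ s ∈ W, (openGraph C).Reachable s o} {C | ∃ s ∈ W, (openGraph C).Reachable s b}
    (bhkMenu_any_isUpperSet W o) (bhkMenu_any_isUpperSet W b) OW BW
    (fun ω => bhkMenu_any_mem W o ω) (fun ω => bhkMenu_any_mem W b ω) hWX
  rw [gluedPair_sep_coe] at h1
  -- (2) Thm 1.4, `C(W)` vs `C(S')`: `μ(N) μ(N∩(O_W∩B')) ≤ μ(N∩O_W) μ(N∩B')`
  have h2 := bhkMenu_two stub_bhkSets.2 w W S'
    {C | ∃ s ∈ W, (openGraph C).Reachable s o} {C | ∃ s ∈ S', (openGraph C).Reachable s b}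
    (bhkMenu_any_isUpperSet W o) (bhkMenu_any_isUpperSet S' b) OW B'
    (fun ω => bhkMenu_any_mem W o ω) (fun ω => bhkMenu_any_mem S' b ω) hWS
  -- (3) Thm 1.3 in `C(S')`: `μ(N∩O') μ(N∩B') ≤ μ(N) μ(N∩(O'∩B'))` (separation written from the `S'` side)
  have h3 := bhkMenu_one stub_bhkSets.1 w S' (W : Set (Fin n))
    {C | ∃ s ∈ S', (openGraph C).Reachable s o} {C | ∃ s ∈ S', (openGraph C).Reachable s b}
    (bhkMenu_any_isUpperSet S' o) (bhkMenu_any_isUpperSet S' b) O' B'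
    (fun ω => bhkMenu_any_mem S' o ω) (fun ω => bhkMenu_any_mem S' b ω) hXW
  rw [gluedPair_sep_coe, gluedPair_sep_symm W S'] at h3
  -- (4) Thm 1.4, `C(S')` vs `C(W)`: `μ(N) μ(N∩(O'∩B_W)) ≤ μ(N∩O') μ(N∩B_W)`
  have h4 := bhkMenu_two stub_bhkSets.2 w S' W
    {C | ∃ s ∈ S', (openGraph C).Reachable s o} {C | ∃ s ∈ W, (openGraph C).Reachable s b}
    (bhkMenu_any_isUpperSet S' o) (bhkMenu_any_isUpperSet W b) O' BW
    (fun ω => bhkMenu_any_mem S' o ω) (fun ω => bhkMenu_any_mem W b ω) hWS.symm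
  rw [gluedPair_sep_symm W S'] at h4
  -- combine: `μ(N)·WT ≥ 0`
  have hα : 0 ≤ μ.real (N ∩ OW) := measureReal_nonneg
  have hβ : 0 ≤ μ.real (N ∩ O') := measureReal_nonneg
  have k1 := mul_le_mul_of_nonneg_left h1 hβ   -- β·(α μ(N∩BW)) ≤ β·(μN μ(N∩(OW∩BW)))
  have k2 := mul_le_mul_of_nonneg_left h2 hβ
  have k3 := mul_le_mul_of_nonneg_left h3 hα
  have k4 := mul_le_mul_of_nonneg_left h4 hα
  have key : 0 ≤ μ.real N * (μ.real (N ∩ OW) * (μ.real (N ∩ (O' ∩ B')) - μ.real (N ∩ (O' ∩ BW))) +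
      μ.real (N ∩ O') * (μ.real (N ∩ (OW ∩ BW)) - μ.real (N ∩ (OW ∩ B')))) := by
    nlinarith [k1, k2, k3, k4]
  by_cases hN0 : μ.real N = 0
  · -- everything inside `N` has measure zero
    have hz : ∀ A : Set (BondConfig (Fin n)), μ.real (N ∩ A) = 0 := fun A =>
      le_antisymm ((measureReal_mono Set.inter_subset_left).trans hN0.le) measureReal_nonneg
    rw [hz, hz, hz, hz, hz, hz]
    simp
  · have hNpos : 0 < μ.real N := lt_of_le_of_ne measureReal_nonneg (Ne.symm hN0)
    by_contra hneg
    push Not at hneg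
    have := mul_neg_of_pos_of_neg hNpos hneg
    linarith [key, this]

end

end Summit.CriticalPhenomena.PercolationContinuityZ3.Theorems
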